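import Mathlib
import HarnessLib
import Literature.MathematicalPhysics.KineticTheory.HardSphereEulerProofs
import Summits.AtomisticToContinuum.HydrodynamicLimit.Theses.OneFlightGossipEngine
import Summits.AtomisticToContinuum.HydrodynamicLimit.Theorems.OneFlightGossipEngineClampedCurrentsDockClampedMeasurable
import Summits.AtomisticToContinuum.HydrodynamicLimit.Theorems.OneFlightGossipEngineKineticCurrentsWindowLDSplit

/-!
# Pathwise family moduli of the clamped rows — stub `stub_sAxisNet` of line `Sketch`,
# crux `LocalClampedTransferLDAlongFamilies` (stmt-AtomisticToContinuum-17691)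

Route `OneFlightGossipEngine`, sub-problem `HydrodynamicLimit`. The finite net in the family parameter `s` compares
the crux's functional at a parameter `s′` with the functional at the nearest node `s₀`, ON THE SAME good orbit. This
file supplies the two pathwise bounds that comparison needs:

* §1 the TRANSFER-CLAMPED collisional rows are linear in the test function (the clamp `ω_iω_j` does not see it) and,
  for a test function that oscillates by at most `L·d` across a contact, are bounded by `L·V·(N+1)/2` after the
  window normalisation `w⁻¹` (the landed `ClampedCurrentsDockClampedMeasurable.abs_collisionSum_clamped_le` with
  the clamp budget `ω_i·Σ(‖Δv_i‖ + |Δ‖v_i‖²|/2) ≤ τV/σ` and the scaling identity `ε_N τ/(σ w) = 1`); applied to the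
  difference `φ_{s′} − φ_{s₀}` of two members of the test family (`L = K|s′ − s₀|`) this is the `s`-modulus of
  the rows;
* §2 the one-body window part of the EOS projection: if two continuous one-body integrands differ by at most
  `ω₁ + ω₂‖v‖²`, their window functionals differ by at most `ω₁·n + ω₂·(window energy)` after `w⁻¹`.

References: S. Olla, S. R. S. Varadhan, H.-T. Yau, Comm. Math. Phys. 155 (1993) §3; H. Spohn, *Large Scale Dynamics
of Interacting Particles* (1991), Part I §2.3.
-/

noncomputable section

open MeasureTheory Set Filter
open scoped ENNReal Topology BigOperators

namespace Summit.AtomisticToContinuum.HydrodynamicLimit.Theorems.LocalClampedTransferSketch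

open Literature.Analysis.FluidPDE (HardSphereFlow Config HardSphereCollisionRecord)
open Literature.MathematicalPhysics.KineticTheory (T3 V3 hsDiameter)
open Literature.Analysis.FluidPDE Literature.MathematicalPhysics.KineticTheory Literature.Analysis.FunctionSpaces
open Summit.AtomisticToContinuum.HydrodynamicLimit.Theorems.ClampedCurrentsDockClampedMeasurable
  (collisionSum_eq_sum_sigma abs_collisionSum_clamped_le)

variable {σ : ℝ} {N : ℕ}

/-! ### §1 The clamped rows: linearity in the test function and the clamp budget -/

/-- **Collision sums along a good orbit over a bounded window are additive in the functional** (finitely many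
collision events). -/
theorem collisionSum_sub (Φ : HardSphereFlow (Torus.geometry (Fin 3)) (hsDiameter σ N) (N + 1))
    {z : Config (N + 1) (Fin 3) T3} (hz : z ∈ Φ.good) (w : ℝ)
    (F G : HardSphereCollisionRecord (Fin 3) T3 (N + 1) → ℝ) :
    Φ.collisionSum (Ioc 0 w) F z - Φ.collisionSum (Ioc 0 w) G z = Φ.collisionSum (Ioc 0 w) (fun c => F c - G c) z := by
  simp only [collisionSum_eq_sum_sigma Φ hz (Ioc_subset_Icc_self (a := (0 : ℝ)) (b := w)), Finset.sum_sub_distrib]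

/-- **The clamped row is linear in the test function**: the difference of the clamped rows with test functions
`φ′` and `φ` (same clamp weights, same impulse) is the clamped row with test function `φ′ − φ`. -/
theorem clampedRow_sub_eq (Φ : HardSphereFlow (Torus.geometry (Fin 3)) (hsDiameter σ N) (N + 1))
    {z : Config (N + 1) (Fin 3) T3} (hz : z ∈ Φ.good) (w : ℝ) (η : Fin (N + 1) → ℝ) (φ φ' : T3 → ℝ)
    (δ : V3 → V3 → ℝ) :
    Φ.collisionSum (Ioc 0 w) (fun c => η c.fst * η c.snd * ((φ' c.fstPos - φ' c.sndPos) * δ c.preVel.1 c.postVel.1) / 2) z -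
      Φ.collisionSum (Ioc 0 w) (fun c => η c.fst * η c.snd * ((φ c.fstPos - φ c.sndPos) * δ c.preVel.1 c.postVel.1) / 2) z =
    Φ.collisionSum (Ioc 0 w)
      (fun c => η c.fst * η c.snd * (((φ' c.fstPos - φ c.fstPos) - (φ' c.sndPos - φ c.sndPos)) *
        δ c.preVel.1 c.postVel.1) / 2) z := by
  rw [collisionSum_sub Φ hz]
  congr 1
  funext c
  ring

/-- **The clamp budget.** With the transfer activity `act_i = (σ/τ)·S_i` and the clamp weight
`ω_i = 𝟙{act_i ≤ V}` (`σ, τ > 0`, `V ≥ 0`): `ω_i · S_i ≤ τV/σ`. -/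
theorem clampWeight_mul_le {σ τ V S : ℝ} (hσ : 0 < σ) (hτ : 0 < τ) (hV : 0 ≤ V) :
    (if σ / τ * S ≤ V then (1 : ℝ) else 0) * S ≤ τ * V / σ := by
  split_ifs with h
  · rw [one_mul]
    have h' : S = τ / σ * (σ / τ * S) := by field_simp
    rw [h']
    calc τ / σ * (σ / τ * S) ≤ τ / σ * V := mul_le_mul_of_nonneg_left h (by positivity)
      _ = τ * V / σ := by ring
  · rw [zero_mul]; positivity

/-- The clamp weight is `0` or `1`. -/
theorem clampWeight_eq_zero_or_one (a V : ℝ) : (if a ≤ V then (1 : ℝ) else 0) = 0 ∨ (if a ≤ V then (1 : ℝ) else 0) = 1 := by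
  split_ifs <;> simp

/-- **The scaling identity** `ε_N · (N+1) · (τV/σ) / 2 · w⁻¹ = V(N+1)/2` (`ε_N = σ(N+1)^{-1/3}`, `w = τ(N+1)^{-1/3}`). -/
theorem hsDiameter_budget_eq {σ τ : ℝ} (hσ : 0 < σ) (hτ : 0 < τ) (N : ℕ) (L V : ℝ) :
    (τ * ((N : ℝ) + 1) ^ (-(1 / 3 : ℝ)))⁻¹ * (L * hsDiameter σ N * ((N : ℝ) + 1) * (τ * V / σ) / 2) =
      L * V * ((N : ℝ) + 1) / 2 := by
  have hN : (0 : ℝ) < (N : ℝ) + 1 := by positivity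
  have hr : 0 < ((N : ℝ) + 1) ^ (-(1 / 3 : ℝ)) := Real.rpow_pos_of_pos hN _
  rw [hsDiameter, Nat.cast_add_one]
  field_simp

/-- **The clamped row with an `L`-Lipschitz (across contacts, minimal-image distance) test function is at most
`L·V·(N+1)/2` after the window normalisation**, on every good orbit (`σ, τ > 0`, `V ≥ 0`; the impulse `δ` dominated
by the transfer impulse). This is the pathwise `s`-modulus of the momentum and energy rows once `ψ = φ_{s′} − φ_{s₀}`
and `L = K|s′ − s₀|`. -/
theorem abs_inv_window_mul_clampedRow_le {σ τ V L : ℝ} (hσ : 0 < σ) (hτ : 0 < τ) (hV : 0 ≤ V) (hL : 0 ≤ L) {N : ℕ}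
    (Φ : HardSphereFlow (Torus.geometry (Fin 3)) (hsDiameter σ N) (N + 1)) {z : Config (N + 1) (Fin 3) T3}
    (hz : z ∈ Φ.good) {ψ : T3 → ℝ} (hψ : ∀ x y, |ψ x - ψ y| ≤ L * Torus.euclidDist x y) {δ : V3 → V3 → ℝ}
    (hδ : ∀ v v', |δ v v'| ≤ ‖v' - v‖ + |‖v'‖ ^ 2 - ‖v‖ ^ 2| / 2) :
    |(τ * ((N : ℝ) + 1) ^ (-(1 / 3 : ℝ)))⁻¹ *
        Φ.collisionSum (Ioc 0 (τ * ((N : ℝ) + 1) ^ (-(1 / 3 : ℝ))))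
          (fun c => (if σ / τ * Φ.collisionSum (Ioc 0 (τ * ((N : ℝ) + 1) ^ (-(1 / 3 : ℝ))))
                (fun c' => if c'.fst = c.fst then ‖c'.postVel.1 - c'.preVel.1‖ +
                  |‖c'.postVel.1‖ ^ 2 - ‖c'.preVel.1‖ ^ 2| / 2 else 0) z ≤ V then (1 : ℝ) else 0) *
            (if σ / τ * Φ.collisionSum (Ioc 0 (τ * ((N : ℝ) + 1) ^ (-(1 / 3 : ℝ))))
                (fun c' => if c'.fst = c.snd then ‖c'.postVel.1 - c'.preVel.1‖ +
                  |‖c'.postVel.1‖ ^ 2 - ‖c'.preVel.1‖ ^ 2| / 2 else 0) z ≤ V then (1 : ℝ) else 0) *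
            ((ψ c.fstPos - ψ c.sndPos) * δ c.preVel.1 c.postVel.1) / 2) z| ≤
      L * V * ((N : ℝ) + 1) / 2 := by
  set w : ℝ := τ * ((N : ℝ) + 1) ^ (-(1 / 3 : ℝ)) with hw
  have hwpos : 0 < w := mul_pos hτ (Real.rpow_pos_of_pos (by positivity) _)
  set S : Fin (N + 1) → ℝ := fun i => Φ.collisionSum (Ioc 0 w)
    (fun c' => if c'.fst = i then ‖c'.postVel.1 - c'.preVel.1‖ + |‖c'.postVel.1‖ ^ 2 - ‖c'.preVel.1‖ ^ 2| / 2
      else 0) z with hS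
  set η : Fin (N + 1) → ℝ := fun i => if σ / τ * S i ≤ V then (1 : ℝ) else 0 with hη
  have hηv : ∀ i, η i = 0 ∨ η i = 1 := fun i => clampWeight_eq_zero_or_one _ _
  have hB : ∀ i, η i * S i ≤ τ * V / σ := fun i => clampWeight_mul_le hσ hτ hV
  have key := abs_collisionSum_clamped_le hσ Φ hz hL hψ hδ hηv (w := w) (B := τ * V / σ) hB
  rw [abs_mul, abs_of_pos (inv_pos.2 hwpos)]
  calc w⁻¹ * |Φ.collisionSum (Ioc 0 w)
          (fun c => η c.fst * η c.snd * ((ψ c.fstPos - ψ c.sndPos) * δ c.preVel.1 c.postVel.1) / 2) z|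
      ≤ w⁻¹ * (L * hsDiameter σ N * ((N : ℝ) + 1) * (τ * V / σ) / 2) :=
        mul_le_mul_of_nonneg_left key (inv_pos.2 hwpos).le
    _ = L * V * ((N : ℝ) + 1) / 2 := hsDiameter_budget_eq hσ hτ N L V

/-! ### §2 The one-body window part -/

/-- **Window functionals of two close one-body integrands are close**: on a good orbit, for continuous `G, G′` with
`|G − G′| ≤ ω₁ + ω₂‖v‖²` pointwise (any real `ω₁, ω₂`) and `w > 0`,
`|w⁻¹(∫₀ʷ Σᵢ G(Φ_r z i) dr − ∫₀ʷ Σᵢ G′(Φ_r z i) dr)| ≤ ω₁·n + ω₂·Σᵢ w⁻¹∫₀ʷ ‖vᵢ(r)‖² dr`. -/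
theorem abs_inv_window_mul_sub_le {ε : ℝ} {n : ℕ} (Φ : HardSphereFlow (Torus.geometry (Fin 3)) ε n)
    {z : Config n (Fin 3) T3} (hz : z ∈ Φ.good) {G G' : T3 × V3 → ℝ} (hG : Continuous G) (hG' : Continuous G')
    {ω₁ ω₂ : ℝ} (hdiff : ∀ y, |G y - G' y| ≤ ω₁ + ω₂ * ‖y.2‖ ^ 2) {w : ℝ} (hw : 0 < w) :
    |w⁻¹ * ((∫ r in (0 : ℝ)..w, ∑ i, G (Φ.flow r z i)) - ∫ r in (0 : ℝ)..w, ∑ i, G' (Φ.flow r z i))| ≤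
      ω₁ * n + ω₂ * ∑ i, w⁻¹ * ∫ r in (0 : ℝ)..w, ‖(Φ.flow r z i).2‖ ^ 2 := by
  have hE : Continuous fun y : T3 × V3 => ‖y.2‖ ^ 2 := by fun_prop
  have hIG : ∀ i, IntervalIntegrable (fun r => G (Φ.flow r z i)) volume 0 w := fun i =>
    intervalIntegrable_comp_orbit Φ hz hG i 0 w
  have hIG' : ∀ i, IntervalIntegrable (fun r => G' (Φ.flow r z i)) volume 0 w := fun i =>
    intervalIntegrable_comp_orbit Φ hz hG' i 0 w
  have hIE : ∀ i, IntervalIntegrable (fun r => ‖(Φ.flow r z i).2‖ ^ 2) volume 0 w := fun i =>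
    intervalIntegrable_comp_orbit Φ hz hE i 0 w
  -- the difference as a sum of window integrals of `G − G′`
  have hsub : (∫ r in (0 : ℝ)..w, ∑ i, G (Φ.flow r z i)) - ∫ r in (0 : ℝ)..w, ∑ i, G' (Φ.flow r z i) =
      ∑ i, ∫ r in (0 : ℝ)..w, (G (Φ.flow r z i) - G' (Φ.flow r z i)) := by
    rw [intervalIntegral.integral_finsetSum fun i _ => hIG i, intervalIntegral.integral_finsetSum fun i _ => hIG' i,
      ← Finset.sum_sub_distrib]
    exact Finset.sum_congr rfl fun i _ => (intervalIntegral.integral_sub (hIG i) (hIG' i)).symm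
  -- each window integral of the difference is at most `ω₁ w + ω₂ ∫ ‖vᵢ‖²`
  have hi : ∀ i, |∫ r in (0 : ℝ)..w, (G (Φ.flow r z i) - G' (Φ.flow r z i))| ≤
      w * ω₁ + ω₂ * ∫ r in (0 : ℝ)..w, ‖(Φ.flow r z i).2‖ ^ 2 := by
    intro i
    have h := intervalIntegral.norm_integral_le_of_norm_le hw.le
      (ae_of_all _ fun r _ => (Real.norm_eq_abs _).trans_le (hdiff (Φ.flow r z i)))
      ((intervalIntegrable_const (c := ω₁)).add ((hIE i).const_mul ω₂))
    rw [intervalIntegral.integral_add (intervalIntegrable_const (c := ω₁)) ((hIE i).const_mul ω₂),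
      intervalIntegral.integral_const, intervalIntegral.integral_const_mul, sub_zero, smul_eq_mul,
      Real.norm_eq_abs] at h
    exact h
  rw [hsub, abs_mul, abs_of_pos (inv_pos.2 hw), Finset.mul_sum]
  calc w⁻¹ * |∑ i, ∫ r in (0 : ℝ)..w, (G (Φ.flow r z i) - G' (Φ.flow r z i))|
      ≤ w⁻¹ * ∑ i, |∫ r in (0 : ℝ)..w, (G (Φ.flow r z i) - G' (Φ.flow r z i))| :=
        mul_le_mul_of_nonneg_left (Finset.abs_sum_le_sum_abs _ _) (inv_pos.2 hw).le
    _ ≤ w⁻¹ * ∑ i, (w * ω₁ + ω₂ * ∫ r in (0 : ℝ)..w, ‖(Φ.flow r z i).2‖ ^ 2) :=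
        mul_le_mul_of_nonneg_left (Finset.sum_le_sum fun i _ => hi i) (inv_pos.2 hw).le
    _ = ω₁ * n + ∑ i, ω₂ * (w⁻¹ * ∫ r in (0 : ℝ)..w, ‖(Φ.flow r z i).2‖ ^ 2) := by
        rw [Finset.sum_add_distrib, Finset.sum_const, Finset.card_univ, Fintype.card_fin, nsmul_eq_mul, mul_add,
          Finset.mul_sum]
        congr 1
        · field_simp
        · exact Finset.sum_congr rfl fun i _ => by ring

/-- **Registered pathwise prelim of stub `stub_sAxisNet`** (line `Sketch`, crux `LocalClampedTransferLDAlongFamilies`):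
the one-body window comparison of §2 in the shape the net consumes. -/
theorem stub_sAxisNetPathwise :
    ∀ (ε : ℝ) (n : ℕ) (Φ : HardSphereFlow (Torus.geometry (Fin 3)) ε n) (z : Config n (Fin 3) T3), z ∈ Φ.good →
      ∀ (G G' : T3 × V3 → ℝ), Continuous G → Continuous G' → ∀ (ω₁ ω₂ : ℝ),
      (∀ y, |G y - G' y| ≤ ω₁ + ω₂ * ‖y.2‖ ^ 2) → ∀ w : ℝ, 0 < w →
      |w⁻¹ * ((∫ r in (0 : ℝ)..w, ∑ i, G (Φ.flow r z i)) - ∫ r in (0 : ℝ)..w, ∑ i, G' (Φ.flow r z i))| ≤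
        ω₁ * n + ω₂ * ∑ i, w⁻¹ * ∫ r in (0 : ℝ)..w, ‖(Φ.flow r z i).2‖ ^ 2 :=
  fun _ _ Φ _ hz _ _ hG hG' _ _ hdiff _ hw => abs_inv_window_mul_sub_le Φ hz hG hG' hdiff hw

end Summit.AtomisticToContinuum.HydrodynamicLimit.Theorems.LocalClampedTransferSketch

end
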